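import Mathlib
import HarnessLib
import HarnessLib.Audit
import Summits.MatrixMultiplication.Statement
import Literature.Computability.AlgebraicComplexity.AsymptoticSpectrum
import Literature.Computability.AlgebraicComplexity.MatMulRankLowerBoundsProofs
import Literature.Barriers.MatrixMultiplication.UniversalMethodBarrier
import HarnessLib.Audit.Status.Attr

/-!
Route: CatalyticDegeneration

DORMANT since 2026-08-22T02:44:38Z (reconciler: no traction for 5 d (last activity item-evidence-added at 2026-08-17T02:06:34Z); parked, not closed — `ledger route dormant route-MatrixMultiplication-CatalyticDegeneration --off` to react) — unstaffed, not closed; items shared with open routes are served there. `ledger route dormant <id> --off` reactivates.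

# Route CatalyticDegeneration — catalysts are free for omega — catalytic border rank, Koszul
cancellation, and Strassen's seventh multiplication on credit

X = CATALYTIC RATE ("it suffices to show X"; realises card catalytic-degeneration): for every ε > 0
there are k ≥ 1, r ≤ 4^{(1+ε)k}
and a bystander 3-tensor C over ℂ (any finite format) such that ⟨r⟩ ⊕ C degenerates (algebraically,
over ℂ[λ], Alman §2.4 =
Literature.Barriers.MatrixMultiplication.PolyDegeneratesTo) to ⟨2^k,2^k,2^k⟩ ⊕ C — the catalyst C is
returned intact. With C = 0 this is
Bini's border-rank criterion for the Kronecker powers of ⟨2,2,2⟩; the point of the route is that C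
is FREE: spectral points are additive,
so a catalytic identity ⟨r⟩ ⊕ C ⊵ ⟨n,n,n⟩ ⊕ C certifies n^ω ≤ r exactly as ⟨r⟩ ⊵ ⟨n,n,n⟩ does
(support item CatalyticTransfer, provable
from the cone: R̃(⟨t⟩ ⊗ ⟨n,n,n⟩) = t·n^ω and degeneration-monotonicity of R̃ are in tree). Define
bR^cat(t) := min{r : ∃ C, ⟨r⟩ ⊕ C ⊵ t ⊕ C};
then R̃ ≤ bR^cat ≤ bR and ω = lim_k (1/k) log₂ bR^cat(⟨2^k⟩³), so X ⟺ ω = 2, with a strictly larger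
feasible set per k whenever
degeneration fails to cancel direct-sum bystanders (crux NonCancellation).
Lean: `∀ ε : ℝ, 0 < ε → ∃ (k r a b c : ℕ) (C : Fin a → Fin b → Fin c → ℂ), 1 ≤ k ∧ 1 ≤ r ∧ (r : ℝ) ≤
(4 : ℝ) ^ ((1 + ε) * k) ∧ Literature.Barriers.MatrixMultiplication.PolyDegeneratesTo
(Literature.Computability.AlgebraicComplexity.directSumTensor
(Literature.Computability.AlgebraicComplexity.unitTensor ℂ r) C)
(Literature.Computability.AlgebraicComplexity.directSumTensor
(Literature.Computability.AlgebraicComplexity.matMulTensor ℂ (2 ^ k) (2 ^ k) (2 ^ k)) C)`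

## Assembly
Pure bookkeeping (Sketch.lean rc 0): given CatalyticTransfer and CatalyticRate, for each ε > 0 take
k ≥ 1, r ≥ 1, C with
⟨r⟩ ⊕ C ⊵ ⟨2^k,2^k,2^k⟩ ⊕ C and r ≤ 4^{(1+ε)k}; CatalyticTransfer with n = 2^k ≥ 2 gives ω ≤
log_{2^k} r ≤ 2(1+ε); with ω ≥ 2
(Literature.CplxAlg.two_le_omega, proved in Theorems/AsymptoticSpectrumOmegaGeTwo.lean) this is ω(ℂ)
= 2 = MatrixMultiplication.

Rationale: WHY THIS LINE. Mechanism (card catalytic-degeneration): enlarge the class of SINGLE identities whose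
existence bounds ω — Bini enlarged rank to border
rank, Schonhage1981 to direct sums of rectangular blocks; here to identities with an untouched
bystander, ⟨r⟩ ⊕ C ⊵ ⟨n,n,n⟩ ⊕ C, which
Strassen duality (Strassen1988 Thm 3.8, PROVED in tree) or the Schönhage multiple-copies argument
makes free for ω. Imported with an
explicit dictionary from quantum resource theory (entanglement catalysis; ChenEtAl2010 proved the
⊗-version for RESTRICTION of ⟨2,2,2⟩
from unit tensors, derived FROM ω < log₂6 — the converse direction): state ↦ 3-tensor,
SLOCC/approximate conversion ↦ restriction /
degeneration, catalyst ↦ bystander C, classical flag ⊕ vs joint system ⊗; and from representation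
theory of quivers, where common direct
summands DO cancel in degenerations of modules (Riedtmann–Zwara, Bongartz), the decisive structural
question whether GL×GL×GL-degeneration
of 3-tensors cancels (it contains Landsberg's open Problem 2 of BuczynskiPostinghelRupniewski2020:
is bR(p ⊕ ⟨1⟩) > bR(p)?). New input
of this route (planner, to be proved as item KoszulCancels): Landsberg–Ottaviani Koszul-flattening
bounds are additive and degeneration-
monotone, hence CANCEL every catalyst, so bR^cat(⟨n,n,n⟩) ≥ 2n² − n; this retracts the card's
single-shot hopes at n = 2 (bR^cat(⟨2,2,2⟩)
≥ 6: no record, no ω = 2 from one 2×2 identity) and locates the catalytic window exactly between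
determinantal certificates (capped at
6n² − 4 by LinearRankMethodBarrier) and true border rank — unpoliced territory for every n. No
existing route or negative touches
catalysis (AsymptoticSpectrum/AsymptoticRankCW are catalyst-free; negatives index empty).

RANKED CRUXES. #0 CatalyticRate (target) — X as in § Thesis: the catalytic border-rank rate of the
Kronecker powers ⟨2^k,2^k,2^k⟩ is 4 (for every ε > 0 some k ≥ 1 admits a catalytic identity with r ≤
4^{(1+ε)k}). (why it might fail: equivalent to ω = 2 (given CatalyticTransfer); if degeneration
cancels catalysts (¬NonCancellation) it is literally the border-rank rate of ⟨2^k⟩ and the route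
adds nothing over AsymptoticSpectrum.) [Blaser2013, Strassen1988, ChristandlVranaZuiddam2023,
Schonhage1981]
#2 NonCancellation (crux) — strict catalysis exists somewhere: there are complex 3-tensors t, C and
r with ⟨r⟩ ⊕ C ⊵ t ⊕ C (PolyDegeneratesTo) but NOT ⟨r⟩ ⊵ t, i.e. degeneration of 3-tensors is not
⊕-cancellative against catalysed unit tensors and bR^cat < bR for some t (card line (1)). Decides
whether bR^cat is a new invariant; a negative answer to Landsberg's Problem 2 (BPR20 p.4, C = ⟨1⟩)
implies it; every known non-additivity example (Schönhage ⟨2,1,3⟩ ⊕ ⟨1,2,1⟩, CW82's T ⊕ ⟨N,1,1⟩) has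
a flattening-deficient partner and gives no catalysis (flattening ranks (7,3,4) < (7,4,5)).
[difficulty: open-problem] (why it might fail: a cancellation theorem for GL³-orbit-closure
degeneration against ⟨r⟩ ⊕ C (as for module degenerations, Bongartz 1996/Zwara 2000) may hold; it
would also settle Landsberg's Problem 2 affirmatively, so it is not cheap, but it kills the route.)
[BuczynskiPostinghelRupniewski2020, Schonhage1981, Landsberg2017, ChenEtAl2010, arXiv:2003.13835]
#3 SeventhOnCredit (crux) — Strassen's seventh multiplication on credit: some bystander C gives ⟨6⟩
⊕ C ⊵ ⟨2,2,2⟩ ⊕ C over ℂ, i.e. bR^cat(⟨2,2,2⟩) = 6 < 7 = bR(⟨2,2,2⟩) (Landsberg2005; HIL 2013; CHL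
2019) — the sharp smallest instance, since KoszulCancels forbids ⟨5⟩. First sub-case: C = ⟨c⟩, i.e.
bR(⟨2,2,2⟩ ⊕ ⟨c⟩) = 6 + c (open: BPR20 Thm 3 stops at dimensions ≤ 4, and M⟨2⟩ ⊕ ⟨1⟩ lives in
ℂ⁵⊗ℂ⁵⊗ℂ⁵); then C = ⟨2,2,2⟩ itself (self-catalysis ⇒ AmortisedStrassen), generic ℂ³⊗ℂ³⊗ℂ³ tensors,
W-type and null-algebra tensors. Gives ω ≤ log₂6 only; its value is the phenomenon. [deps:
NonCancellation] [difficulty: L] (why it might fail: the non-determinantal certificates of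
bR(M⟨2⟩)=7 (Landsberg's orbit analysis, HIL13 degree-20 invariant, border apolarity) may extend to
σ_{6+bR(C)} ∋ M⟨2⟩ ⊕ C for all C, i.e. bR^cat(⟨2,2,2⟩) = 7 even if NonCancellation holds elsewhere.)
[Landsberg2005, ConnerHarperLandsberg2019, BuczynskaBuczynski2021,
BuczynskiPostinghelRupniewski2020, LandsbergOttaviani2015]
#4 KoszulCancels (crux) — Koszul-flattening (Landsberg–Ottaviani) lower bounds cancel every
catalyst: if ⟨r⟩ ⊕ C ⊵ t ⊕ C then rank K_Φ^{(p)}(t) ≤ binom(2p,p)·r for every p and every Φ : ℂ^a →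
ℂ^{2p+1} (so bR^cat ≥ the LO bound; bR^cat(⟨n,n,n⟩) ≥ 2n² − n, bR^cat(⟨2,2,2⟩) ≥ 6). Planner's proof
sketch: compress the first factors of t and C into one ℂ^{2p+1} by Φ ⊕ Ψ₀ (Ψ₀ maximising rank
K_Ψ(C)); the Koszul matrix of a direct sum is block-diagonal in the (κ, μ)-indices
(koszulFlattening_add), hence ranks add; Koszul flattenings are equivariant (B, C act on the two
matrix factors, A composes into Φ) and the rank of a lowest-order λ-coefficient is at most the rank
over ℂ(λ) (rank_le_rank_map_of_perturbation); max rank over ℂ(λ) = max over ℂ (infinite field);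
subtract rank K_{Ψ₀}(C). [difficulty: M] (why it might fail: the sketch is the planner's
(unpublished): the field-extension step (max rank over ℂ(λ) attained over ℂ) or the compression of
BOTH first factors into one ℂ^{2p+1} could hide a gap; if so r ≤ 5 reopens for ⟨2,2,2⟩.)
[LandsbergOttaviani2015, Landsberg2017, EfremenkoGargOliveiraWigderson2018, Buczynski2026]
#5 AmortisedStrassen (crux) — border rank is strictly subadditive on copies of ⟨2,2,2⟩: for some m ≥
1, ⟨r⟩ ⊵ ⟨m⟩ ⊗ ⟨2,2,2⟩ with r < 7m (m independent 2×2 products approximately for fewer than 7m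
multiplications). Self-catalysis ⟨6⟩ ⊕ (m−1)·M⟨2⟩ ⊵ m·M⟨2⟩ implies it with r = 7m − 1; by the proved
τ-theorem (Blaser2013_thm75_holds) it certifies ω ≤ log₂(r/m) < log₂7 from 2×2 blocks alone; lim_m
bR(m·M⟨2⟩)/m ∈ [6, 7] (KoszulCancels-type additivity gives 6) and R̃-amortisation gives 2^ω ≤ 5.18
per copy, so the question is where ⊕-amortisation sits between ⊗-amortisation and no amortisation.
[difficulty: open-problem] (why it might fail: bR(m·M⟨2⟩) = 7m for all m is the expert default
(rigidity of M⟨2⟩: Strassen's algorithm is the unique optimal rank decomposition, de Groote 1978); a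
border-apolarity / Hilbert-function argument for block-diagonal tensors could prove it.)
[Schonhage1981, Blaser2013, Landsberg2017, CoppersmithWinograd1982,
BuczynskiPostinghelRupniewski2020]
#9 CatalyticTransfer (support) — catalytic Bini–Schönhage transfer (soundness of the mechanism): for
n ≥ 2, r ≥ 1 and any bystander C, ⟨r⟩ ⊕ C ⊵ ⟨n,n,n⟩ ⊕ C implies ω(ℂ) ≤ log_n r. Proof from the cone:
iterate with the catalyst returned (⟨Nr⟩ ⊕ C ⊵ N·⟨n,n,n⟩ ⊕ C by ⊕-compatibility + transitivity +
reindexing of PolyDegeneratesTo), drop C on the right (projection) and replace it by ⟨R(C)⟩ on the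
left, so ⟨Nr + R(C)⟩ ⊵ ⟨N⟩ ⊗ ⟨n,n,n⟩; then asymptoticRank_le_of_polyDegeneratesTo and
asymptoticRank_multiple_matMulTensor_cube give N·n^ω ≤ Nr + R(C) for all N, hence n^ω ≤ r.
(Alternative: strassen_duality_asymptoticRank_holds once spectral points are shown
degeneration-monotone.) Needs the lemma PolyDegeneratesTo.directSum (not yet in tree). [difficulty:
provable-now] [Blaser2013, Strassen1988, AlmanDuanVassilevskaWilliamsXuXuZhou2025, Alman2021]

TWO-LAYER PLAN. Foreseen glued splits (filed only after a crux closes): NonCancellation ⇐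
LandsbergUnitM2 (bR(M⟨2⟩ ⊕ ⟨1⟩) = 7?) | SchoenhagePairCatalysis
(catalysis inside the ⟨e,1,ℓ⟩ ⊕ ⟨1,(e−1)(ℓ−1),1⟩ configurations) | GenericCubeCatalysis (t generic
in ℂ³⊗ℂ³⊗ℂ³, bR 5, flattenings 3);
CatalyticTransfer ⇐ DirectSumDegeneration (⊕-compatibility of PolyDegeneratesTo) → CatalystIteration
→ CatalyticTransfer;
KoszulCancels ⇐ KoszulEquivariance → KoszulDirectSumRank → KoszulCancels; after SeventhOnCredit
closes positively: the ω-relevant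
instance ⟨45⟩ ⊕ C ⊵ ⟨5,5,5⟩ ⊕ C (r = 45 = 2n² − n is the Koszul-cancellative floor, and log₅45 =
2.365 < 2.3713 — the smallest cubic
format where a catalytic identity can beat the record without contradicting KoszulCancels) and the
Kronecker-power targets of CatalyticRate.

KILL CRITERIA. ¬NonCancellation proved (⊕-cancellation of tensor degeneration against catalysed unit
tensors) ⇒ bR^cat = bR, the mechanism adds nothing
over border rank: close `refuted:NonCancellation` (CatalyticRate then restates AsymptoticSpectrum's
X_A and is superseded by it).
SeventhOnCredit refuted alone (bR^cat(⟨2,2,2⟩) = 7) ⇒ pivot the smallest instance to ⟨3,3,3⟩ (window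
[15, 17..20]) and to
AmortisedStrassen; not fatal. KoszulCancels refuted ⇒ the pruning is wrong and r ≤ 5 for ⟨2,2,2⟩
reopens (restate, good news).
AmortisedStrassen refuted (bR(m·M⟨2⟩) = 7m ∀ m) ⇒ drop the self-catalysis sub-line (catalysts must
be foreign tensors). ω = 2 proved on any
other route moots this one; a proof that every universal spectral point is a limit of cancellative
determinantal bounds would too.

NOT DECOMPOSED YET. The definition catalyticBorderRank (kept inline as ∃ C); ⊗-catalysts (⟨r⟩ ⊗ C ⊵
t ⊗ C, equally free for ω by duality — left out to stay
thin; ChenEtAl2010 territory); rectangular / direct-sum block targets in τ-theorem form; the search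
technology (border apolarity for
⟨r⟩ ⊕ C exploiting the symmetry of C, numerical λ-homotopy) — these are prover/kit methods, not
statements; the all-fields version; the
degeneration-monotonicity of universal spectral points (only needed for the duality proof of
CatalyticTransfer); any CW82-type strictness
for catalytic identities (InfimumNotMinimum analogue) — interesting but not load-bearing since X
carries ε.

CHEAPEST FALSIFIER. (1) Lookup: is ⊕-cancellation of GL(A)×GL(B)×GL(C)-orbit-closure degeneration a
known theorem (Kronecker-quiver / King θ-stability
literature, Bongartz–Zwara transferred to tensors)? A positive hit kills the route at once. Searched
today (lit vsearch, galaxy substring,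
Landsberg2017 §3.3/§5.3, BPR20): not found; BPR20 p.4 records even the C = ⟨1⟩ case (Landsberg's
Problem 2) as open. (2) Kit (not run in
plancard mode): Newton/ALS search for λ-families with h ≤ 3 realising ⟨7⟩ ⊵ M⟨2⟩ ⊕ ⟨1⟩ in ℂ⁵⊗ℂ⁵⊗ℂ⁵
and ⟨13⟩ ⊵ 2·M⟨2⟩ in ℂ⁸⊗ℂ⁸⊗ℂ⁸; a
border-apolarity run (CHL19 scale) deciding M⟨2⟩ ⊕ ⟨1⟩ ∉ σ₇ would settle the first sub-case of
SeventhOnCredit negatively.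

NUMBERS. bR(⟨2,2,2⟩) = 7 (Landsberg2005; HIL13; ConnerHarperLandsberg2019); Koszul/LO: bR(⟨n,n,n⟩) ≥
2n² − n (LandsbergOttaviani2015), border
substitution 2n² − ⌈log₂n⌉ − 1 (LandsbergMichalek2018, cancellativity unknown); bR(⟨3,3,3⟩) ∈ [17,
20]; determinantal ceiling 6n² − 4
(Buczynski2026, LinearRankMethodBarrier); ω ≤ 2.371339 (advxxz2025_omega_le); R̃(⟨n,n,n⟩) = n^ω and
R̃(⟨t⟩ ⊗ ⟨n,n,n⟩) = t·n^ω (tree,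
proved); log₂6 = 2.585, log₂6.5 = 2.700, log₂7 = 2.807, log₅45 = 2.365; BPR20 Thm 3: border rank
additive when all three total
dimensions ≤ 4; Schönhage: bR(⟨2,1,3⟩ ⊕ ⟨1,2,1⟩) = 7 < 6 + 2 (smallest known non-additivity). Items
at open: 7 (1 target, 1 assembly,
4 cruxes, 1 support).

DEFINITION REQUESTS. None needed: PolyDegeneratesTo (Literature.Barriers.MatrixMultiplication),
directSumTensor, unitTensor, kroneckerTensor, matMulTensor,
omega, koszulFlattening (Literature.Computability.AlgebraicComplexity) exist; bR^cat is inlined.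
Wanted lemma (prover, --supports
CatalyticTransfer): PolyDegeneratesTo.directSum.

Novelty: Searches (2026-08-15): `lit search "catalysis tensor degeneration direct sum border rank
cancellation"` and `… --source openalex|arxiv|s2`
(searchd down / HTTP 429 — 0 rows, recorded); `lit vsearch "direct sum of tensors, degeneration,
cancellation of a common summand; catalytic
conversion …" -k 12` (1 relevant: Landsberg2017 pp.124–125, §5.3.2 Strassen additivity, §3.3.2
Schönhage); `lit galaxy search "border rank is
not additive" --star all` (3 hits: BurgisserClausenShokrollahi1997, Stothers 2010 ×2); `lit galaxy
search "entanglement catalysis" --star pdf`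
(queue saturated); `lit read arxiv:1902.06582 --grep …` (BPR20: Problem 2 of Landsberg p.4, Thm 3);
`lit read book:landsberg2017 --grep
additivity|cataly` (15 lines, no catalysis); lean tree: no decl mentioning catalysis except CLGLZ's
diagonal-catalyst T-methods in
RectangularBarrier; plus the card's and the novelty audit's searches (galaxy 'catalytic border rank'
0 hits; zbMATH 'tensor catalysis SLOCC',
'degenerations of tensors cancellation').
Nearest prior art found: Schonhage1981 (⊕ non-additivity turned into ω bounds via the τ-theorem);
ChenEtAl2010 = doi:10.1103/physrevlett.105.200501
(⊗-catalysis for restriction of ⟨2,2,2⟩ from ⟨6⟩, derived from ω < log₂6);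
BuczynskiPostinghelRupniewski2020 (Landsberg's Problem 2: unit-summand
border-rank additivity open; additivity for dims ≤ 4); ChristandlLeGallLysikovZuiddam2025 §1.3.3
(catalytic T-methods with diagonal catalysts,
barred); arXiv:2003.13835 (Fritz: abstract cata  [refs: 10.1103/physrevlett.105.200501, 1902.06582, 2003.13835, arxiv:1902.06582, book:landsberg2017, doi:10.1103/physrevlett.105.200501, Landsberg2017, BurgisserClausenShokrollahi1997, Schonhage1981, ChenEtAl2010, BuczynskiPostinghelRupniewski2020, ChristandlLeGallLysikovZuiddam2025]

Barriers (technique_class: catalytic-degeneration, direct-sum-catalyst): - technique_class: catalytic-degeneration, direct-sum-catalyst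
- Literature.Barriers.MatrixMultiplication.InfimumNotMinimumBarrier: CW82 strictness is stated for
bR of direct sums of matrix blocks without bystander; it applies verbatim to AmortisedStrassen-type
identities (each certifies ω < log₂(r/m) strictly, never ω = 2) and plausibly to catalytic ones;
evaded by design — CatalyticRate carries ε and k → ∞, no single identity is asked to certify ω = 2.
- Literature.Barriers.MatrixMultiplication.LinearRankMethodBarrier: used as a RESOURCE, not evaded:
KoszulCancels says determinantal (Koszul) certificates are catalytic lower bounds, and the barrier
caps them at 6n² − 4 on ⟨n,n,n⟩, so no known cancellative method can police bR^cat(⟨n,n,n⟩) above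
6n² − 4; the catalytic window is provably invisible to rank methods.
- Literature.Barriers.MatrixMultiplication.UniversalMethodBarrier: bounds what degenerations of
POWERS of a fixed intermediate tensor T can certify; here the resource is ⟨r⟩ ⊕ C degenerating once
to ⟨n,n,n⟩ ⊕ C — no intermediate tensor is powered (ω_u(⟨r⟩) is unobstructed); would re-enter only
if a search fixed C of CW-type and powered it, which no item does.
- Literature.Barriers.MatrixMultiplication.IrreversibilityBarrier: same class remark —
irreversibility of an intermediate tensor is irrelevant when the source is the unit tensor plus a
returned bystander; the catalyst's irreversibility costs nothing because it is not consumed.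
- Literature.Barriers.MatrixMultipl

History (route lifecycle, newest last):
- 2026-08-16T04:10:35Z · AUTO-CRUX (backfill): CatalyticRate — hypotheses of the deciding theorem that nothing in the route derives are cruxes (operator:999:1085951)
- 2026-08-22T02:44:38Z · DORMANT — reconciler: no traction for 5 d (last activity item-evidence-added at 2026-08-17T02:06:34Z); parked, not closed — `ledger route dormant route-MatrixMultiplicati (operator:999:2537690)

sub-problem: MatrixMultiplication · status: dormant · opened planner-plancard-MatrixMultiplication-MatrixM-442b683d-0 2026-08-15T11:21:10Z · rev 1 · ledger route-MatrixMultiplication-CatalyticDegeneration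
GENERATED by the gate from the ledger (D-0016/17). Provers cite these decls: `theorem foo : Summit.MatrixMultiplication.MatrixMultiplication.Theses.CatalyticDegeneration.<Decl> := …` in Summits/MatrixMultiplication/MatrixMultiplication/Theorems/<Name>.lean.
-/

namespace Summit.MatrixMultiplication.MatrixMultiplication.Theses.CatalyticDegeneration

open scoped BigOperators Topology Manifold Classical MeasureTheory ProbabilityTheory Matrix InnerProductSpace ComplexConjugate ContinuousMap
open Filter Set Function TopologicalSpace MeasureTheory

attribute [summit_statement] _root_.MatrixMultiplication

/-- item stmt-MatrixMultiplication-3634 · crux (kind.auto-crux: conjecture-grade) · rank 0 · open · by planner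
why it might fail: equivalent to ω = 2 (given CatalyticTransfer); if degeneration cancels catalysts (¬NonCancellation) it is literally the border-rank rate of ⟨2^k⟩ and the route adds nothing over AsymptoticSpectrum.
sources: Blaser2013, Strassen1988, ChristandlVranaZuiddam2023, Schonhage1981
[target] X as in § Thesis: the catalytic border-rank rate of the Kronecker powers ⟨2^k,2^k,2^k⟩ is 4
(for every ε > 0 some k ≥ 1 admits a catalytic identity with r ≤ 4^{(1+ε)k}). -/
@[route_item "route-MatrixMultiplication-CatalyticDegeneration", crux]
def CatalyticRate : Prop :=
  ∀ ε : ℝ, 0 < ε → ∃ (k r a b c : ℕ) (C : Fin a → Fin b → Fin c → ℂ), 1 ≤ k ∧ 1 ≤ r ∧ (r : ℝ) ≤ (4 : ℝ) ^ ((1 + ε) * k) ∧ Literature.Barriers.MatrixMultiplication.PolyDegeneratesTo (Literature.Computability.AlgebraicComplexity.directSumTensor (Literature.Computability.AlgebraicComplexity.unitTensor ℂ r) C) (Literature.Computability.AlgebraicComplexity.directSumTensor (Literature.Computability.AlgebraicComplexity.matMulTensor ℂ (2 ^ k) (2 ^ k) (2 ^ k)) C)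

/-- item stmt-MatrixMultiplication-3635 · crux · rank 2 · open · by planner
why it might fail: a cancellation theorem for GL³-orbit-closure degeneration against ⟨r⟩ ⊕ C (as for module degenerations, Bongartz 1996/Zwara 2000) may hold; it would also settle Landsberg's Problem 2 affirmatively, so it is not cheap, but it kills the route.
sources: BuczynskiPostinghelRupniewski2020, Schonhage1981, Landsberg2017, ChenEtAl2010, arXiv:2003.13835
[crux] strict catalysis exists somewhere: there are complex 3-tensors t, C and r with ⟨r⟩ ⊕ C ⊵ t ⊕
C (PolyDegeneratesTo) but NOT ⟨r⟩ ⊵ t, i.e. degeneration of 3-tensors is not ⊕-cancellative against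
catalysed unit tensors and bR^cat < bR for some t (card line (1)). Decides whether bR^cat is a new
invariant; a negative answer to Landsberg's Problem 2 (BPR20 p.4, C = ⟨1⟩) implies it; every known
non-additivity example (Schönhage ⟨2,1,3⟩ ⊕ ⟨1,2,1⟩, CW82's T ⊕ ⟨N,1,1⟩) has a flattening-deficient
partner and gives no catalysis (flattening ranks (7,3,4) < (7,4,5)). [difficulty: open-problem] -/
@[route_item "route-MatrixMultiplication-CatalyticDegeneration"]
def NonCancellation : Prop :=
  ∃ (a b c a' b' c' r : ℕ) (t : Fin a → Fin b → Fin c → ℂ) (C : Fin a' → Fin b' → Fin c' → ℂ), Literature.Barriers.MatrixMultiplication.PolyDegeneratesTo (Literature.Computability.AlgebraicComplexity.directSumTensor (Literature.Computability.AlgebraicComplexity.unitTensor ℂ r) C) (Literature.Computability.AlgebraicComplexity.directSumTensor t C) ∧ ¬ Literature.Barriers.MatrixMultiplication.PolyDegeneratesTo (Literature.Computability.AlgebraicComplexity.unitTensor ℂ r) t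

/-- item stmt-MatrixMultiplication-3636 · crux · rank 3 · open · by planner
why it might fail: the non-determinantal certificates of bR(M⟨2⟩)=7 (Landsberg's orbit analysis, HIL13 degree-20 invariant, border apolarity) may extend to σ_{6+bR(C)} ∋ M⟨2⟩ ⊕ C for all C, i.e. bR^cat(⟨2,2,2⟩) = 7 even if NonCancellation holds elsewhere.
sources: Landsberg2005, ConnerHarperLandsberg2019, BuczynskaBuczynski2021, BuczynskiPostinghelRupniewski2020, LandsbergOttaviani2015
[crux] Strassen's seventh multiplication on credit: some bystander C gives ⟨6⟩ ⊕ C ⊵ ⟨2,2,2⟩ ⊕ C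
over ℂ, i.e. bR^cat(⟨2,2,2⟩) = 6 < 7 = bR(⟨2,2,2⟩) (Landsberg2005; HIL 2013; CHL 2019) — the sharp
smallest instance, since KoszulCancels forbids ⟨5⟩. First sub-case: C = ⟨c⟩, i.e. bR(⟨2,2,2⟩ ⊕ ⟨c⟩)
= 6 + c (open: BPR20 Thm 3 stops at dimensions ≤ 4, and M⟨2⟩ ⊕ ⟨1⟩ lives in ℂ⁵⊗ℂ⁵⊗ℂ⁵); then C =
⟨2,2,2⟩ itself (self-catalysis ⇒ AmortisedStrassen), generic ℂ³⊗ℂ³⊗ℂ³ tensors, W-type and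
null-algebra tensors. Gives ω ≤ log₂6 only; its value is the phenomenon. [deps: NonCancellation]
[difficulty: L] -/
@[route_item "route-MatrixMultiplication-CatalyticDegeneration"]
def SeventhOnCredit : Prop :=
  ∃ (a b c : ℕ) (C : Fin a → Fin b → Fin c → ℂ), Literature.Barriers.MatrixMultiplication.PolyDegeneratesTo (Literature.Computability.AlgebraicComplexity.directSumTensor (Literature.Computability.AlgebraicComplexity.unitTensor ℂ 6) C) (Literature.Computability.AlgebraicComplexity.directSumTensor (Literature.Computability.AlgebraicComplexity.matMulTensor ℂ 2 2 2) C)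

/-- item stmt-MatrixMultiplication-3637 · crux · rank 4 · open · by planner
why it might fail: the sketch is the planner's (unpublished): the field-extension step (max rank over ℂ(λ) attained over ℂ) or the compression of BOTH first factors into one ℂ^{2p+1} could hide a gap; if so r ≤ 5 reopens for ⟨2,2,2⟩.
sources: LandsbergOttaviani2015, Landsberg2017, EfremenkoGargOliveiraWigderson2018, Buczynski2026
[crux] Koszul-flattening (Landsberg–Ottaviani) lower bounds cancel every catalyst: if ⟨r⟩ ⊕ C ⊵ t ⊕
C then rank K_Φ^{(p)}(t) ≤ binom(2p,p)·r for every p and every Φ : ℂ^a → ℂ^{2p+1} (so bR^cat ≥ the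
LO bound; bR^cat(⟨n,n,n⟩) ≥ 2n² − n, bR^cat(⟨2,2,2⟩) ≥ 6). Planner's proof sketch: compress the
first factors of t and C into one ℂ^{2p+1} by Φ ⊕ Ψ₀ (Ψ₀ maximising rank K_Ψ(C)); the Koszul matrix
of a direct sum is block-diagonal in the (κ, μ)-indices (koszulFlattening_add), hence ranks add;
Koszul flattenings are equivariant (B, C act on the two matrix factors, A composes into Φ) and the
rank of a lowest-order λ-coefficient is at most the rank over ℂ(λ)
(rank_le_rank_map_of_perturbation); max rank over ℂ(λ) = max over ℂ (infinite field); subtract rank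
K_{Ψ₀}(C). [difficulty: M] -/
@[route_item "route-MatrixMultiplication-CatalyticDegeneration"]
def KoszulCancels : Prop :=
  ∀ (p a b c a' b' c' r : ℕ) (Φ : (Fin a → ℂ) →ₗ[ℂ] (Fin (2 * p + 1) → ℂ)) (t : Fin a → Fin b → Fin c → ℂ) (C : Fin a' → Fin b' → Fin c' → ℂ), Literature.Barriers.MatrixMultiplication.PolyDegeneratesTo (Literature.Computability.AlgebraicComplexity.directSumTensor (Literature.Computability.AlgebraicComplexity.unitTensor ℂ r) C) (Literature.Computability.AlgebraicComplexity.directSumTensor t C) → (Literature.Computability.AlgebraicComplexity.koszulFlattening p Φ t).rank ≤ (2 * p).choose p * r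

/-- item stmt-MatrixMultiplication-3638 · crux · rank 5 · open · by planner
why it might fail: bR(m·M⟨2⟩) = 7m for all m is the expert default (rigidity of M⟨2⟩: Strassen's algorithm is the unique optimal rank decomposition, de Groote 1978); a border-apolarity / Hilbert-function argument for block-diagonal tensors could prove it.
sources: Schonhage1981, Blaser2013, Landsberg2017, CoppersmithWinograd1982, BuczynskiPostinghelRupniewski2020
[crux] border rank is strictly subadditive on copies of ⟨2,2,2⟩: for some m ≥ 1, ⟨r⟩ ⊵ ⟨m⟩ ⊗ ⟨2,2,2⟩
with r < 7m (m independent 2×2 products approximately for fewer than 7m multiplications).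
Self-catalysis ⟨6⟩ ⊕ (m−1)·M⟨2⟩ ⊵ m·M⟨2⟩ implies it with r = 7m − 1; by the proved τ-theorem
(Blaser2013_thm75_holds) it certifies ω ≤ log₂(r/m) < log₂7 from 2×2 blocks alone; lim_m
bR(m·M⟨2⟩)/m ∈ [6, 7] (KoszulCancels-type additivity gives 6) and R̃-amortisation gives 2^ω ≤ 5.18
per copy, so the question is where ⊕-amortisation sits between ⊗-amortisation and no amortisation.
[difficulty: open-problem] -/
@[route_item "route-MatrixMultiplication-CatalyticDegeneration"]
def AmortisedStrassen : Prop :=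
  ∃ (m r : ℕ), r < 7 * m ∧ Literature.Barriers.MatrixMultiplication.PolyDegeneratesTo (Literature.Computability.AlgebraicComplexity.unitTensor ℂ r) (Literature.Computability.AlgebraicComplexity.kroneckerTensor (Literature.Computability.AlgebraicComplexity.unitTensor ℂ m) (Literature.Computability.AlgebraicComplexity.matMulTensor ℂ 2 2 2))

/-- item stmt-MatrixMultiplication-3639 · support · rank 9 · closed · proved by Summit.MatrixMultiplication.MatrixMultiplication.Theorems.catalyticTransfer_proof @ 045c7b513df3 (prover) · by planner
sources: Blaser2013, Strassen1988, AlmanDuanVassilevskaWilliamsXuXuZhou2025, Alman2021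
[support] catalytic Bini–Schönhage transfer (soundness of the mechanism): for n ≥ 2, r ≥ 1 and any
bystander C, ⟨r⟩ ⊕ C ⊵ ⟨n,n,n⟩ ⊕ C implies ω(ℂ) ≤ log_n r. Proof from the cone: iterate with the
catalyst returned (⟨Nr⟩ ⊕ C ⊵ N·⟨n,n,n⟩ ⊕ C by ⊕-compatibility + transitivity + reindexing of
PolyDegeneratesTo), drop C on the right (projection) and replace it by ⟨R(C)⟩ on the left, so ⟨Nr +
R(C)⟩ ⊵ ⟨N⟩ ⊗ ⟨n,n,n⟩; then asymptoticRank_le_of_polyDegeneratesTo and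
asymptoticRank_multiple_matMulTensor_cube give N·n^ω ≤ Nr + R(C) for all N, hence n^ω ≤ r.
(Alternative: strassen_duality_asymptoticRank_holds once spectral points are shown
degeneration-monotone.) Needs the lemma PolyDegeneratesTo.directSum (not yet in tree). [difficulty:
provable-now] -/
@[route_item "route-MatrixMultiplication-CatalyticDegeneration", crux]
def CatalyticTransfer : Prop :=
  ∀ (n r a b c : ℕ) (C : Fin a → Fin b → Fin c → ℂ), 2 ≤ n → 1 ≤ r → Literature.Barriers.MatrixMultiplication.PolyDegeneratesTo (Literature.Computability.AlgebraicComplexity.directSumTensor (Literature.Computability.AlgebraicComplexity.unitTensor ℂ r) C) (Literature.Computability.AlgebraicComplexity.directSumTensor (Literature.Computability.AlgebraicComplexity.matMulTensor ℂ n n n) C) → Literature.Computability.AlgebraicComplexity.omega ℂ ≤ Real.logb n r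

/-- item stmt-MatrixMultiplication-3640 · assembly · rank 1 · closed · proved by Summit.MatrixMultiplication.MatrixMultiplication.Theorems.catalyticDegeneration_assembly_proof @ c03ddcce3628 (prover) · by planner
sources: Blaser2013
[assembly] CatalyticTransfer → CatalyticRate → MatrixMultiplication (ω(ℂ) = 2). -/
@[route_item "route-MatrixMultiplication-CatalyticDegeneration"]
def Assembly : Prop :=
  CatalyticTransfer → CatalyticRate → MatrixMultiplication

/-! D-0027 §2.1 — DECIDING THEOREM (planner-authored via `route open/edit --closes-file`; by planner-rbadge-MatrixMultiplication-CatalyticD-6559c090-g2-0 2026-08-15T16:12:11Z):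
its hypotheses are this route's items and its conclusion the sub-problem Statement (glue_lint), and it elaborates with this file. -/

/-- Deciding theorem (D-0027 §2.1): the catalytic transfer (soundness) and the catalytic rate of the
Kronecker powers `⟨2^k,2^k,2^k⟩` give `ω(ℂ) ≤ 2 + δ` for every `δ > 0` (take `ε = δ/2`, `n = 2^k ≥ 2`:
`ω ≤ log_{2^k} r ≤ (1+δ/2)·k·log 4 / (k·log 2) = 2 + δ`), and `2 ≤ ω(ℂ)` is the flattening bound
`omega_two_le` (Literature/…/FlatteningBound.lean, in the cone); hence `ω(ℂ) = 2 = MatrixMultiplication`. -/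
@[closes "route-MatrixMultiplication-CatalyticDegeneration"] theorem closes (hT : CatalyticTransfer) (hR : CatalyticRate) : MatrixMultiplication := by
  rw [MatrixMultiplication_iff]
  refine le_antisymm ?_ (Literature.Computability.AlgebraicComplexity.omega_two_le ℂ)
  refine le_of_forall_pos_le_add fun δ hδ => ?_
  obtain ⟨k, r, a, b, c, C, hk, hr, hrle, hdeg⟩ := hR (δ / 2) (by positivity)
  have hn : 2 ≤ 2 ^ k :=
    calc 2 = 2 ^ 1 := (pow_one 2).symm
      _ ≤ 2 ^ k := Nat.pow_le_pow_right (by norm_num) hk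
  have hω := hT (2 ^ k) r a b c C hn hr hdeg
  refine hω.trans ?_
  have hk0 : (0 : ℝ) < k := by exact_mod_cast hk
  have hlog2 : 0 < Real.log 2 := Real.log_pos (by norm_num)
  have hbpos : 0 < Real.log ((2 : ℝ) ^ k) := by
    rw [Real.log_pow]; positivity
  have hr0 : (0 : ℝ) < r := by exact_mod_cast hr
  have h4 : Real.log (r : ℝ) ≤ (1 + δ / 2) * k * Real.log 4 := by
    have := Real.log_le_log hr0 hrle
    rwa [Real.log_rpow (by norm_num : (0 : ℝ) < 4)] at this
  have hlog4 : Real.log 4 = 2 * Real.log 2 := by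
    rw [show (4 : ℝ) = 2 ^ 2 by norm_num, Real.log_pow]; norm_num
  rw [hlog4] at h4
  push_cast
  rw [Real.logb, div_le_iff₀ hbpos, Real.log_pow]
  calc Real.log (r : ℝ) ≤ (1 + δ / 2) * k * (2 * Real.log 2) := h4
    _ = (2 + δ) * (k * Real.log 2) := by ring

end Summit.MatrixMultiplication.MatrixMultiplication.Theses.CatalyticDegeneration
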